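import Summits.BirchSwinnertonDyer.BirchSwinnertonDyer.Theorems.ByReductionTypeAtTwoRankOneSigmaSqRigidity
import Literature.NumberTheory.EllipticCurves.CanonicalPAdicHeightSqExistenceProofs
import HarnessLib

/-!
# Route `ByReductionTypeAtTwo`, crux `RankOneAtTwoBigImageOddLocal` (item stmt-BirchSwinnertonDyer-23715), line AN62, σ₀-LEMMA BLOCK
# (cell `bsd-f1-sign2`, planner seat `-an` g49; `--supports 23715`, helper): **rescaling calculus for two-variable `p`-adic evaluation,
# and the SQUARED formal theta relation for every normalised solution of the sigma-squared equation**

HONEST FRAMING (D-0036/D-0054): THEOREMS ONLY (no definition, no named fact, no `sorry`, no instance); formal-group algebra and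
`p`-adic analysis, NOT a statement about `BSDp`; item 23715 stays OPEN; BSD is proved for no curve.  Step 1a of the CONSTRUCTION
item 50D of `Cruxes/RankOneAtTwoBigImageOddLocal/WildPairHeightAN62.lean` (a `PAdicHeightData` at a good SUPERSINGULAR `2` built from
the naive `Σ₀`, which converges only on `v₂(t) > 1`, Bernardi 1981 §1): the companion file `…SigmaSqThetaPoints.lean` transports the
formal theta relation along `(u, v) ↦ (pu, pv)` with the lemmas of §1 and evaluates it at points.

* §1 (every `p`): `padicEval₂_rescale` (`(rescale p G)(u, v) = G(pu, pv)`), `padicEval₂_smul`, `rescale_subst` (rescaling commutes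
  with `f.subst`), `rescale_subst_eq_subst_smul` (`f(aX) ∘ G = f ∘ (a·G)`), `rescale_X_fin_two`, `constantCoeff_rescale_fin_two`,
  `isPadicInt_rescale`, `isPadicInt_powerSeries_rescale`, `isPadicInt_inv_smul_rescale` (`G(pu,pv)/p ∈ ℤ_p⟦u,v⟧` when `G(0,0) = 0`).
* §2 `thetaSq_formal_sq` — `Σ(u +_F v)Σ(u -_F v)u⁴v⁴ = (u²X(v) − v²X(u))²Σ(u)²Σ(v)²` for `Σ = σ²`, `σ` ANY normalised odd solution
  of the sigma equation (any constant: the tree's `thetaLHS_eq_thetaRHS`, squared — i.e. the tree's `IsMazurTateSigmaSqPair.thetaSq_formal`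
  without the integrality it does not use); `thetaSq_formal_of_coeff_three` — the same for EVERY normalised solution of
  `SatisfiesSigmaSqODE · 0` with `[t³]Σ = a₁` (rigidity `eq_of_satisfiesSigmaSqODE`: `Σ = σ₀²`).

References: [cite: MazurTate1991, Thm. 3.1 (theta relation)] [cite: BlakestadGrant2023, Prop. 14] [cite: MazurSteinTate2006, Thm. 1.3, §3.1].
-/

set_option autoImplicit false

noncomputable section

open scoped Classical

open PowerSeries WeierstrassCurve Literature.NumberTheory.EllipticCurves

namespace Summit.BirchSwinnertonDyer.BirchSwinnertonDyer.Theorems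

namespace NaiveSigmaLogAtTwo

/-! ### §1 Rescaling calculus for two-variable `p`-adic evaluation -/

section Rescale

variable {p : ℕ} [Fact p.Prime]

/-- `(rescale a G)(u, v) = G(au, av)` (termwise). -/
theorem padicEval₂_rescale (a : ℚ_[p]) (G : MvPowerSeries (Fin 2) ℚ_[p]) (u v : ℚ_[p]) :
    padicEval₂ (MvPowerSeries.rescale (Function.const (Fin 2) a) G) u v = padicEval₂ G (a * u) (a * v) := by
  unfold padicEval₂
  refine tsum_congr fun d => ?_
  rw [MvPowerSeries.coeff_rescale, finsupp_prod_pow_fin_two]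
  simp only [Function.const_apply, mul_pow]
  ring

/-- `(c • G)(u, v) = c·G(u, v)` (termwise; no integrality needed). -/
theorem padicEval₂_smul (c : ℚ_[p]) (G : MvPowerSeries (Fin 2) ℚ_[p]) (u v : ℚ_[p]) :
    padicEval₂ (c • G) u v = c * padicEval₂ G u v := by
  unfold padicEval₂
  rw [← tsum_mul_left]
  refine tsum_congr fun d => ?_
  rw [MvPowerSeries.coeff_smul]; ring

/-- Rescaling commutes with substitution into a one-variable series. -/
theorem rescale_subst (a : ℚ_[p]) (f : ℚ_[p]⟦X⟧) {G : MvPowerSeries (Fin 2) ℚ_[p]}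
    (hG : MvPowerSeries.constantCoeff G = 0) :
    MvPowerSeries.rescale (Function.const (Fin 2) a) (f.subst G) =
      f.subst (MvPowerSeries.rescale (Function.const (Fin 2) a) G) := by
  rw [MvPowerSeries.rescale_eq_subst, MvPowerSeries.rescale_eq_subst]
  unfold PowerSeries.subst
  rw [MvPowerSeries.subst_comp_subst_apply
    (PowerSeries.HasSubst.const (PowerSeries.HasSubst.of_constantCoeff_zero hG)) (MvPowerSeries.HasSubst.smul_X _)]

/-- `f(aX) ∘ G = f ∘ (a·G)`. -/
theorem rescale_subst_eq_subst_smul (a : ℚ_[p]) (f : ℚ_[p]⟦X⟧) {τ : Type*} {G : MvPowerSeries τ ℚ_[p]}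
    (hG : PowerSeries.HasSubst G) :
    (rescale a f).subst G = f.subst (a • G) := by
  rw [PowerSeries.rescale_eq_subst, PowerSeries.subst_comp_subst_apply
    (PowerSeries.HasSubst.of_constantCoeff_zero' (by simp)) hG,
    PowerSeries.subst_smul hG, PowerSeries.subst_X hG]

/-- The rescaled variable: `rescale a (X i) = a • X i`. -/
theorem rescale_X_fin_two (a : ℚ_[p]) (i : Fin 2) :
    MvPowerSeries.rescale (Function.const (Fin 2) a) (MvPowerSeries.X i : MvPowerSeries (Fin 2) ℚ_[p]) =
      a • MvPowerSeries.X i := by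
  ext d
  rw [MvPowerSeries.coeff_rescale, MvPowerSeries.coeff_smul, MvPowerSeries.coeff_X]
  split_ifs with h
  · subst h
    simp [Finsupp.prod_single_index]
  · simp

/-- Rescaling does not change the constant coefficient. -/
theorem constantCoeff_rescale_fin_two (a : ℚ_[p]) (G : MvPowerSeries (Fin 2) ℚ_[p]) :
    MvPowerSeries.constantCoeff (MvPowerSeries.rescale (Function.const (Fin 2) a) G) =
      MvPowerSeries.constantCoeff G := by
  rw [← MvPowerSeries.coeff_zero_eq_constantCoeff_apply, MvPowerSeries.coeff_rescale, finsupp_prod_pow_fin_two,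
    MvPowerSeries.coeff_zero_eq_constantCoeff_apply]
  simp

/-- `G(au, av) ∈ ℤ_p⟦u, v⟧` for `‖a‖ ≤ 1` and `G` integral. -/
theorem isPadicInt_rescale {a : ℚ_[p]} (ha : ‖a‖ ≤ 1) {G : MvPowerSeries (Fin 2) ℚ_[p]} (hG : IsPadicInt G) :
    IsPadicInt (MvPowerSeries.rescale (Function.const (Fin 2) a) G) := by
  intro d
  rw [MvPowerSeries.coeff_rescale, finsupp_prod_pow_fin_two, norm_mul]
  simp only [Function.const_apply, norm_mul, norm_pow]
  calc ‖a‖ ^ d 0 * ‖a‖ ^ d 1 * ‖MvPowerSeries.coeff d G‖ ≤ 1 ^ d 0 * 1 ^ d 1 * 1 := by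
        gcongr
        exact hG d
    _ = 1 := by simp

/-- `f(at) ∈ ℤ_p⟦t⟧` for `‖a‖ ≤ 1` and `f` integral. -/
theorem isPadicInt_powerSeries_rescale {a : ℚ_[p]} (ha : ‖a‖ ≤ 1) {f : ℚ_[p]⟦X⟧} (hf : IsPadicInt f) :
    IsPadicInt (rescale a f) := by
  rw [isPadicInt_iff_coeff] at hf ⊢
  intro n
  rw [coeff_rescale, norm_mul, norm_pow]
  calc ‖a‖ ^ n * ‖coeff n f‖ ≤ 1 ^ n * 1 := by gcongr; exact hf n
    _ = 1 := by simp

/-- `G(pu, pv)/p ∈ ℤ_p⟦u, v⟧` when `G` is integral with `G(0,0) = 0`. -/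
theorem isPadicInt_inv_smul_rescale {G : MvPowerSeries (Fin 2) ℚ_[p]} (hG : IsPadicInt G)
    (hG0 : MvPowerSeries.constantCoeff G = 0) :
    IsPadicInt ((p : ℚ_[p])⁻¹ • MvPowerSeries.rescale (Function.const (Fin 2) (p : ℚ_[p])) G) := by
  have hp : ‖(p : ℚ_[p])‖ = (p : ℝ)⁻¹ := Padic.norm_p
  have hp1 : (1 : ℝ) < p := by exact_mod_cast (Fact.out : p.Prime).one_lt
  intro d
  rw [MvPowerSeries.coeff_smul, MvPowerSeries.coeff_rescale, finsupp_prod_pow_fin_two]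
  simp only [Function.const_apply]
  by_cases hd : d = 0
  · subst hd
    simp [MvPowerSeries.coeff_zero_eq_constantCoeff_apply, hG0]
  · have hdeg : 1 ≤ d 0 + d 1 := by
      rcases Nat.eq_zero_or_pos (d 0 + d 1) with h | h
      · exfalso; apply hd; ext i; fin_cases i <;> simp_all
      · exact h
    rw [← pow_add, ← mul_assoc, norm_mul, norm_mul, norm_inv, norm_pow, hp, inv_inv, inv_pow]
    calc (p : ℝ) * ((p : ℝ) ^ (d 0 + d 1))⁻¹ * ‖MvPowerSeries.coeff d G‖
        ≤ (p : ℝ) * ((p : ℝ) ^ 1)⁻¹ * 1 := by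
          gcongr
          · exact hp1.le
          · exact hG d
      _ = 1 := by rw [pow_one, mul_inv_cancel₀ (by positivity), one_mul]

end Rescale

/-! ### §2 The squared formal theta relation -/

section ThetaFormal

variable {p : ℕ} [Fact p.Prime] (V : WeierstrassCurve ℚ_[p]) [V.IsIntegral ℤ_[p]] [V.IsElliptic]

/-- **The squared theta relation for `Σ = σ²`**, `σ` any normalised odd solution of the sigma equation (any constant `c`):
`Σ(u +_F v)·Σ(u -_F v)·u⁴v⁴ = (u²X(v) − v²X(u))²·Σ(u)²·Σ(v)²` in `ℚ_p⟦u, v⟧`. [cite: BlakestadGrant2023, Prop. 14]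
[cite: MazurTate1991, Thm. 3.1] -/
theorem thetaSq_formal_sq {σ : ℚ_[p]⟦X⟧} {c : ℚ_[p]} (hσ0 : constantCoeff σ = 0) (hσ1 : coeff 1 σ = 1)
    (hodd : V.IsFormallyOdd σ) (hODE : V.SatisfiesSigmaODE σ c) :
    (σ ^ 2).subst V.formalGroupLaw * (σ ^ 2).subst V.formalGroupLawSub *
        (MvPowerSeries.X 0 : MvPowerSeries (Fin 2) ℚ_[p]) ^ 4 * (MvPowerSeries.X 1) ^ 4 =
      ((MvPowerSeries.X 0) ^ 2 * V.formalXMulSq.subst (MvPowerSeries.X 1 : MvPowerSeries (Fin 2) ℚ_[p]) -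
          (MvPowerSeries.X 1) ^ 2 * V.formalXMulSq.subst (MvPowerSeries.X 0 : MvPowerSeries (Fin 2) ℚ_[p])) ^ 2 *
        (σ ^ 2).subst (MvPowerSeries.X 0 : MvPowerSeries (Fin 2) ℚ_[p]) ^ 2 *
        (σ ^ 2).subst (MvPowerSeries.X 1 : MvPowerSeries (Fin 2) ℚ_[p]) ^ 2 := by
  have hθ := thetaLHS_eq_thetaRHS hσ0 hσ1 hodd hODE
  have hθ2 : V.thetaLHS σ ^ 2 = V.thetaRHS σ ^ 2 := by rw [hθ]
  unfold thetaLHS thetaRHS at hθ2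
  rw [PowerSeries.subst_pow V.hasSubst_formalGroupLaw, PowerSeries.subst_pow V.hasSubst_formalGroupLawSub,
    PowerSeries.subst_pow (PowerSeries.HasSubst.X 0), PowerSeries.subst_pow (PowerSeries.HasSubst.X 1)]
  linear_combination hθ2

/-- **The squared theta relation for the constant-`0` normalised solution** `Σ` (`[t⁰] = [t¹] = 0`, `[t²] = 1`, `[t³] = a₁`) of
`SatisfiesSigmaSqODE · 0`: `Σ = σ₀²` for the odd constant-`0` sigma function (rigidity), hence `thetaSq_formal_sq`.
[cite: MazurSteinTate2006, Thm. 1.3, §3.1] [cite: MazurTate1991, Thm. 3.1] -/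
theorem thetaSq_formal_of_coeff_three {Sq : ℚ_[p]⟦X⟧} (h0 : constantCoeff Sq = 0) (h1 : coeff 1 Sq = 0)
    (h2 : coeff 2 Sq = 1) (h3 : coeff 3 Sq = V.a₁) (hODE : V.SatisfiesSigmaSqODE Sq 0) :
    Sq.subst V.formalGroupLaw * Sq.subst V.formalGroupLawSub *
        (MvPowerSeries.X 0 : MvPowerSeries (Fin 2) ℚ_[p]) ^ 4 * (MvPowerSeries.X 1) ^ 4 =
      ((MvPowerSeries.X 0) ^ 2 * V.formalXMulSq.subst (MvPowerSeries.X 1 : MvPowerSeries (Fin 2) ℚ_[p]) -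
          (MvPowerSeries.X 1) ^ 2 * V.formalXMulSq.subst (MvPowerSeries.X 0 : MvPowerSeries (Fin 2) ℚ_[p])) ^ 2 *
        Sq.subst (MvPowerSeries.X 0 : MvPowerSeries (Fin 2) ℚ_[p]) ^ 2 *
        Sq.subst (MvPowerSeries.X 1 : MvPowerSeries (Fin 2) ℚ_[p]) ^ 2 := by
  obtain ⟨σ, hσ0, hσ1, hodd, hσODE⟩ := V.exists_isFormallyOdd_satisfiesSigmaODE_zero
  have hT0 : constantCoeff (σ ^ 2) = 0 := by rw [map_pow, hσ0, zero_pow two_ne_zero]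
  have hT1 : coeff 1 (σ ^ 2) = 0 := by
    rw [pow_two, coeff_one_mul_eq, coeff_zero_eq_constantCoeff_apply, hσ0]; ring
  have hT2 : coeff 2 (σ ^ 2) = 1 := by
    rw [pow_two, coeff_two_mul_eq, coeff_zero_eq_constantCoeff_apply, hσ0, hσ1]; ring
  have hT3 : coeff 3 Sq = coeff 3 (σ ^ 2) := by
    rw [h3]
    exact mul_left_cancel₀ two_ne_zero (two_mul_coeff_three_of_isFormallyEven hodd.sq hT0 hT1 hT2).symm
  rw [eq_of_satisfiesSigmaSqODE V h0 h1 h2 hT0 hT1 hT2 hT3 hODE (hσODE.sq hσ0 hσ1)]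
  exact thetaSq_formal_sq V hσ0 hσ1 hodd hσODE

end ThetaFormal

end NaiveSigmaLogAtTwo

end Summit.BirchSwinnertonDyer.BirchSwinnertonDyer.Theorems
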